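/-
Copyright (c) 2026 the pub-hodgecm-mathlib formalisation cell (harness21).  Prover seat hodgecm-mathlib-LH4-p13 (g8), req620 Track A «(D-RAM) FOUR-FRAME» squad, tier 0,
STAGE-1b (dealer LH4-plan (g13) WORD #91 «B2b-2 TWO-SLOT (GLUED) ORBIT LABELLED COUNT»; LH4-p11 (g8) SPEC-B2 v1 §3; twin of F0P3-p01 (g36) ★ `F0P3cDyRamLabelledOddOneSlotRead`):
brick (L-lab-20b) «THE LABELLED ODD COUNT OF A CLASS-SIGN LABEL»: for ANY label that reads `Λ M₀ (D₁·u) ↔ λ(u) = 1` on `S_F(M₀)` with a sign function `λ` constant on the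
classes modulo `N(S̃′(M₀))` — the one-slot `λ = ε·ω(u_k)` of ★ g36 and the two-slot `λ = ω(u₀G₀ + u₁G₁)` of ★ (L-lab-20a) alike — `2·m^Λ_i(M₀) = ω(D_{1,i})·Σ_{r ∈ R} ω(r_i)(1 + λ(r))`
over any representative system `R` of `S_F ∕ N(S̃′)`.  2026-09-04.
-/
import Summits.HodgeConjecture.HodgeConjecture.Theorems.F0P3cDyRamLabelledOddOneSlotRead   -- ★ (F0P3-p01 (g36), B2b-1): `cl_eq_cl_iff`, `mem_polarisationNormClasses_iff_exists_cl`, `map_unitNormMap_unitStabilizer_le`,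
                                                                                          -- `normSign_mul_eq_of_mem_map_unitNormMap`; brings ★ p860257 DEFS, ★ `normSign_mul_of_dichotomy`, `normSign_eq_one_or`
import HarnessLib

/-!
# Crux `H413`, line LH4 «(D-RAM) FOUR-FRAME», STAGE-1b — (L-lab-20b) «THE LABELLED ODD COUNT OF A CLASS-SIGN LABEL (ONE- AND TWO-SLOT ALIKE)»

Cell `hodgecm-mathlib` (D-0151), FLOOR 0, crux item H413 = `stmt-HodgeConjecture-24833`, route of record `HCCMUnconditional`; squad F0∕P3c∕LH4.  THEOREMS ONLY (no `def`, no
instance, no notation, no `sorry`, default heartbeats), ★-only imports, lane `--supports stmt-HodgeConjecture-24833`.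

Setting of ★ g36 HEAD A: the type-`tv` polarisations of `M₀` form the coset `D₁·S_F(M₀)` (`hcoset`), `N′ = N(S̃′(M₀)) ≤ S_F(M₀)`, classes `cl u = D₁·u·N′`.  A CLASS-SIGN LABEL is a
label `Λ` with `Λ M₀ (D₁·u) ↔ λ(u) = 1` for a function `λ : S_F → {±1}`; it is automatically `N′`-invariant when `Λ` is torus-equivariant (§1).
* §1 `label_mul_norm_iff_of_isTorusEquivariantLabel` (`Λ M₀ (D·N(s)) ↔ Λ M₀ D` for a unit stabiliser `s`: (INV) of SPEC-B2 §1); `classSign_mul_eq_of_label` (`λ(u·n) = λ(u)`, `n ∈ N′`).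
* §2 `classLabelSign_cl_eq_of_classSign` — `classLabelSign σ i (Λ M₀) (cl u) = if λ(u) = 1 then ω(D_{1,i})·ω(u_i) else 0` (★ g36 `classLabelSign_cl_eq` with `ε·ω(u_k)` replaced by `λ(u)`).
* §3 HEAD **`two_mul_labelledOddCount_eq_sum_of_classSign`** — for any representative system `R ⊆ S_F` of `S_F ∕ N′` (a `Finset`, `∀ u ∈ S_F, ∃! r ∈ R, u⁻¹·r ∈ N′`):
  `2 · labelledOddCount σ ϖ tv i Λ M₀ = ω(D_{1,i}) · Σ_{r ∈ R} ω(r_i)·(1 + λ(r))` — the B2b-2 twisted sum, with the binary-norm-form character sum `Σ_r ω(r_i)·λ(r)` left EXPLICIT for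
  LH4-p14 (g6)'s B3 (two-slot: `λ(r) = ω(r₀G₀ + r₁G₁) = ω(r₀)·ω(G₀ + (r₁∕r₀)G₁)`).

HONEST LABEL: count-neutral (generic bookkeeping of the (β-BAL) Stage-B labelled count); nothing summed to `0` here.  HC_CM remains proved only modulo the printed citations
(2 remaining named inputs: hLiu418 = `stmt-HodgeConjecture-24832`, h413 = `stmt-HodgeConjecture-24833`) until rung 0 closes.
-/

noncomputable section

namespace Summit.HodgeConjecture.HodgeConjecture.Cruxes.H413.F0P3cDyRamLabelledOddClassSignRead

open Literature.NumberTheory.Automorphic Literature.NumberTheory.Automorphic.HermitianLattice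
open Literature.NumberTheory.Automorphic.UnitaryLatticeTree Literature.NumberTheory.Automorphic.UnitaryThreeFourFrame
open Summit.HodgeConjecture.HodgeConjecture.Cruxes.H413.F0P3cDyRamFourFramePieces
open Summit.HodgeConjecture.HodgeConjecture.Cruxes.H413.F0P3cDyRamDiagonalTorusDefs
open Summit.HodgeConjecture.HodgeConjecture.Cruxes.H413.F0P3cDyRamLabelledOddCountDefs
open Summit.HodgeConjecture.HodgeConjecture.Cruxes.H413.F0P3cDyRamDiagonalKappaCountEval (normSign_mul_of_dichotomy fixed_of_mem_fixedUnitStabilizer)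
open Summit.HodgeConjecture.HodgeConjecture.Cruxes.H413.F0P3cDyRamStableSumSignClasses (normSign_eq_one_or)
open Summit.HodgeConjecture.HodgeConjecture.Cruxes.H413.F0P3cDyRamLabelledOddOneSlotRead
open scoped Valued WithZero Matrix MatrixGroups

variable {K : Type} [Field K] [Valued K ℤᵐ⁰]
variable {σ : K →+* K} {ϖ : K} {tv : ℕ} {M₀ : Submodule 𝒪[K] (Fin 3 → K)} {D₁ : Fin 3 → K}

/-! ## §1  Torus-equivariant labels are constant on the classes modulo `N(S̃′)` -/

/-- **(INV) `Λ(M₀, D·N(s)) ↔ Λ(M₀, D)` FOR A UNIT STABILISER `s`** of `M₀` and a torus-equivariant label `Λ` (★ p860257 `IsTorusEquivariantLabel`): `Λ(diag(s)M₀, D) = Λ(M₀, D·N(s))` and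
`diag(s)M₀ = M₀`. [cite: Kottwitz1986BaseChangeUnits, §1 pp. 240–241] -/
theorem label_mul_norm_iff_of_isTorusEquivariantLabel {Λ : Submodule 𝒪[K] (Fin 3 → K) → (Fin 3 → K) → Prop} (hΛ : IsTorusEquivariantLabel σ Λ)
    {n : Fin 3 → Kˣ} (hn : n ∈ (unitStabilizer M₀).map (unitNormMap σ 3)) (D : Fin 3 → K) :
    Λ M₀ (fun j => D j * ((n j : Kˣ) : K)) ↔ Λ M₀ D := by
  obtain ⟨s, hs, rfl⟩ := hn
  have hsM : mapGL (diagGLUnits s) M₀ = M₀ := ((mem_unitStabilizer_iff M₀ s).1 hs).1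
  have h := hΛ s M₀ D
  rw [hsM] at h
  simp only [unitNormMap_apply]
  exact h.symm

/-- **A CLASS-SIGN READ IS `N′`-INVARIANT**: if `Λ M₀ (D₁·u) ↔ λ(u) = 1` on `S_F(M₀)` with `λ ∈ {±1}`, `Λ` torus-equivariant and `N′ ≤ S_F`, then `λ(u·n) = λ(u)` for `n ∈ N′`.
[cite: Kottwitz1986BaseChangeUnits, §1 pp. 240–241] -/
theorem classSign_mul_eq_of_label {Λ : Submodule 𝒪[K] (Fin 3 → K) → (Fin 3 → K) → Prop} (hΛeq : IsTorusEquivariantLabel σ Λ)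
    (hNS : (unitStabilizer M₀).map (unitNormMap σ 3) ≤ fixedUnitStabilizer σ M₀) {lam : (Fin 3 → Kˣ) → ℤ}
    (hlam : ∀ u ∈ fixedUnitStabilizer σ M₀, lam u = 1 ∨ lam u = -1)
    (hΛ : ∀ u ∈ fixedUnitStabilizer σ M₀, Λ M₀ (fun j => D₁ j * ((u j : Kˣ) : K)) ↔ lam u = 1)
    {u : Fin 3 → Kˣ} (hu : u ∈ fixedUnitStabilizer σ M₀) {n : Fin 3 → Kˣ} (hn : n ∈ (unitStabilizer M₀).map (unitNormMap σ 3)) :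
    lam (u * n) = lam u := by
  have hun : u * n ∈ fixedUnitStabilizer σ M₀ := mul_mem hu (hNS hn)
  have key : lam (u * n) = 1 ↔ lam u = 1 := by
    rw [← hΛ _ hun, ← hΛ _ hu]
    have h := label_mul_norm_iff_of_isTorusEquivariantLabel (M₀ := M₀) hΛeq hn (fun j => D₁ j * ((u j : Kˣ) : K))
    simp only [Pi.mul_apply, Units.val_mul, mul_assoc] at h ⊢
    exact h
  rcases hlam _ hun with h1 | h1 <;> rcases hlam _ hu with h2 | h2
  · rw [h1, h2]
  · exact absurd (key.1 h1) (by rw [h2]; norm_num)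
  · exact absurd (key.2 h2) (by rw [h1]; norm_num)
  · rw [h1, h2]

/-! ## §2  The signed label of a class under a class-sign label -/

/-- **THE SIGNED LABEL OF A CLASS UNDER A CLASS-SIGN LABEL**: `Λ M₀ (D₁·u) ↔ λ(u) = 1` on `S_F(M₀)`, `λ` `N′`-invariant, `N′ ≤ S_F` ⟹ on `cl u` both `Λ M₀` and `ω(·_i)` are constant and
`classLabelSign σ i (Λ M₀) (cl u) = if λ(u) = 1 then ω(D_{1,i})·ω(u_i) else 0` (★ g36 `classLabelSign_cl_eq`, `ε·ω(u_k)` replaced by `λ(u)`).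
[cite: Kottwitz1986BaseChangeUnits, §1 pp. 240–241] [cite: LanglandsShelstad1987, §3] -/
theorem classLabelSign_cl_eq_of_classSign {c : K} (hσc : σ c = c) (hc : ¬ ∃ z : K, z * σ z = c)
    (hdich : ∀ x : K, σ x = x → x ≠ 0 → (∃ z : K, z * σ z = x) ∨ ∃ z : K, z * σ z = c * x)
    (hD₁ : ∀ j, σ (D₁ j) = D₁ j ∧ D₁ j ≠ 0) (hNS : (unitStabilizer M₀).map (unitNormMap σ 3) ≤ fixedUnitStabilizer σ M₀)
    (Λ : Submodule 𝒪[K] (Fin 3 → K) → (Fin 3 → K) → Prop) (i : Fin 3) {lam : (Fin 3 → Kˣ) → ℤ}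
    (hlamN : ∀ u ∈ fixedUnitStabilizer σ M₀, ∀ n ∈ (unitStabilizer M₀).map (unitNormMap σ 3), lam (u * n) = lam u)
    (hΛ : ∀ u ∈ fixedUnitStabilizer σ M₀, Λ M₀ (fun j => D₁ j * ((u j : Kˣ) : K)) ↔ lam u = 1)
    {u : Fin 3 → Kˣ} (hu : u ∈ fixedUnitStabilizer σ M₀) :
    classLabelSign σ i (Λ M₀) {D' : Fin 3 → K | ∃ n ∈ (unitStabilizer M₀).map (unitNormMap σ 3), ∀ j, D' j = D₁ j * ((u j : Kˣ) : K) * ((n j : Kˣ) : K)} =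
      if lam u = 1 then normSign σ (D₁ i) * normSign σ ((u i : Kˣ) : K) else 0 := by
  classical
  set C := {D' : Fin 3 → K | ∃ n ∈ (unitStabilizer M₀).map (unitNormMap σ 3), ∀ j, D' j = D₁ j * ((u j : Kˣ) : K) * ((n j : Kˣ) : K)} with hC
  have hfixu := fixed_of_mem_fixedUnitStabilizer σ hu
  have hmem : (fun j => D₁ j * ((u j : Kˣ) : K)) ∈ C := ⟨1, one_mem _, fun j => by simp⟩
  have hconst : ∀ D' ∈ C, (Λ M₀ D' ↔ lam u = 1) ∧ normSign σ (D' i) = normSign σ (D₁ i) * normSign σ ((u i : Kˣ) : K) := by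
    rintro D' ⟨n, hn, hDn⟩
    have hun : u * n ∈ fixedUnitStabilizer σ M₀ := mul_mem hu (hNS hn)
    have hD'eq : D' = fun j => D₁ j * (((u * n) j : Kˣ) : K) := funext fun j => by
      rw [hDn j, Pi.mul_apply, Units.val_mul, mul_assoc]
    refine ⟨?_, ?_⟩
    · rw [hD'eq, hΛ _ hun, hlamN u hu n hn]
    · rw [hDn i, normSign_mul_eq_of_mem_map_unitNormMap σ hn,
        normSign_mul_of_dichotomy σ hσc hc hdich (hD₁ i).1 (hfixu i).1 (hD₁ i).2 (hfixu i).2]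
  split_ifs with halive
  · rcases normSign_eq_one_or σ (D₁ i * ((u i : Kˣ) : K)) with h1 | h1 <;>
      rw [normSign_mul_of_dichotomy σ hσc hc hdich (hD₁ i).1 (hfixu i).1 (hD₁ i).2 (hfixu i).2] at h1 <;> rw [h1]
    · exact classLabelSign_eq_one_of_forall σ i (Λ M₀) fun D' hD' => ⟨(hconst D' hD').1.2 halive, (hconst D' hD').2.trans h1⟩
    · exact classLabelSign_eq_neg_one_of_forall σ i (Λ M₀) ⟨_, hmem⟩ fun D' hD' => ⟨(hconst D' hD').1.2 halive, (hconst D' hD').2.trans h1⟩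
  · exact classLabelSign_eq_zero_of_not σ i (Λ M₀) hmem fun hP => halive ((hconst _ hmem).1.1 hP)

/-! ## §3  HEAD — the labelled odd count as an explicit sum over a representative system -/

/-- Pointwise bookkeeping: for `a ∈ {±1}`, `2·[a = 1]·s = s·(1 + a)`. [cite: LanglandsShelstad1987, §3] -/
theorem two_mul_ite_eq_mul_one_add {a : ℤ} (ha : a = 1 ∨ a = -1) (s : ℤ) : 2 * (if a = 1 then s else 0) = s * (1 + a) := by
  rcases ha with rfl | rfl
  · rw [if_pos rfl]; ring
  · norm_num

/-- **HEAD — THE LABELLED ODD COUNT OF A CLASS-SIGN LABEL OVER A REPRESENTATIVE SYSTEM.**  Polarisations of `M₀` = `D₁·S_F(M₀)` (`hcoset`); `Λ M₀ (D₁·u) ↔ λ(u) = 1` on `S_F` with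
`λ ∈ {±1}` `N′`-invariant; `R` a finite representative system of `S_F ∕ N(S̃′)` (`R ⊆ S_F`, `∀ u ∈ S_F, ∃! r ∈ R, u⁻¹·r ∈ N′`).  Then
`2 · labelledOddCount σ ϖ tv i Λ M₀ = ω(D_{1,i}) · Σ_{r ∈ R} ω(r_i)·(1 + λ(r))` (classes `↔ R` by ★ g36 `cl_eq_cl_iff`; §2 per class).  Two-slot (★ (L-lab-20a)):
`λ(r) = ω(r₀G₀ + r₁G₁)`, and `Σ_r ω(r_i)λ(r)` is LH4-p14's binary-norm-form character sum. [cite: Kottwitz1986BaseChangeUnits, §1 pp. 240–241] [cite: LanglandsShelstad1987, §3] -/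
theorem two_mul_labelledOddCount_eq_sum_of_classSign {c : K} (hσc : σ c = c) (hc : ¬ ∃ z : K, z * σ z = c)
    (hdich : ∀ x : K, σ x = x → x ≠ 0 → (∃ z : K, z * σ z = x) ∨ ∃ z : K, z * σ z = c * x)
    (hD₁ : ∀ j, σ (D₁ j) = D₁ j ∧ D₁ j ≠ 0) (hV₁ : IsVertexLattice σ ϖ (Matrix.diagonal D₁) tv M₀) (hσ : ∀ x, σ (σ x) = x)
    (hcoset : ∀ D : Fin 3 → K, (∀ j, σ (D j) = D j ∧ D j ≠ 0) →
      (IsVertexLattice σ ϖ (Matrix.diagonal D) tv M₀ ↔ ∃ u ∈ fixedUnitStabilizer σ M₀, ∀ j, D j = D₁ j * ((u j : Kˣ) : K)))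
    (Λ : Submodule 𝒪[K] (Fin 3 → K) → (Fin 3 → K) → Prop) (i : Fin 3) {lam : (Fin 3 → Kˣ) → ℤ}
    (hlam : ∀ u ∈ fixedUnitStabilizer σ M₀, lam u = 1 ∨ lam u = -1)
    (hlamN : ∀ u ∈ fixedUnitStabilizer σ M₀, ∀ n ∈ (unitStabilizer M₀).map (unitNormMap σ 3), lam (u * n) = lam u)
    (hΛ : ∀ u ∈ fixedUnitStabilizer σ M₀, Λ M₀ (fun j => D₁ j * ((u j : Kˣ) : K)) ↔ lam u = 1)
    (R : Finset (Fin 3 → Kˣ)) (hRS : ∀ r ∈ R, r ∈ fixedUnitStabilizer σ M₀)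
    (hR : ∀ u ∈ fixedUnitStabilizer σ M₀, ∃! r, r ∈ R ∧ u⁻¹ * r ∈ (unitStabilizer M₀).map (unitNormMap σ 3)) :
    2 * labelledOddCount σ ϖ tv i Λ M₀ = normSign σ (D₁ i) * ∑ r ∈ R, normSign σ ((r i : Kˣ) : K) * (1 + lam r) := by
  classical
  set N' := (unitStabilizer M₀).map (unitNormMap σ 3) with hN'def
  have hNS : N' ≤ fixedUnitStabilizer σ M₀ := map_unitNormMap_unitStabilizer_le σ hσ ϖ tv hD₁ hV₁ hcoset
  set cl : (Fin 3 → Kˣ) → Set (Fin 3 → K) := fun u =>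
    {D' : Fin 3 → K | ∃ n ∈ N', ∀ j, D' j = D₁ j * ((u j : Kˣ) : K) * ((n j : Kˣ) : K)} with hcldef
  -- the classes are in bijection with `R`
  have hbij : Set.BijOn cl (↑R : Set (Fin 3 → Kˣ)) (polarisationNormClasses σ ϖ tv M₀) := by
    refine ⟨fun r hr => (mem_polarisationNormClasses_iff_exists_cl hD₁ hcoset _).2 ⟨r, hRS r hr, rfl⟩, fun r hr r' hr' hrr' => ?_, fun C hC => ?_⟩
    · have hmem : r⁻¹ * r' ∈ N' := (cl_eq_cl_iff hD₁ r r').1 hrr'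
      obtain ⟨r₀, -, huniq⟩ := hR r (hRS r hr)
      have h1 := huniq r ⟨hr, by rw [inv_mul_cancel]; exact one_mem _⟩
      have h2 := huniq r' ⟨hr', hmem⟩
      rw [h1, h2]
    · obtain ⟨u, hu, rfl⟩ := (mem_polarisationNormClasses_iff_exists_cl hD₁ hcoset C).1 hC
      obtain ⟨r, ⟨hr, hur⟩, -⟩ := hR u hu
      exact ⟨r, hr, ((cl_eq_cl_iff hD₁ u r).2 hur).symm⟩
  have hsum : labelledOddCount σ ϖ tv i Λ M₀ = ∑ r ∈ R, classLabelSign σ i (Λ M₀) (cl r) := by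
    rw [labelledOddCount_eq, ← finsum_mem_eq_of_bijOn (f := fun r => classLabelSign σ i (Λ M₀) (cl r)) cl hbij (fun _ _ => rfl), finsum_mem_coe_finset]
  rw [hsum, Finset.mul_sum, Finset.mul_sum]
  refine Finset.sum_congr rfl fun r hr => ?_
  rw [show cl r = {D' : Fin 3 → K | ∃ n ∈ (unitStabilizer M₀).map (unitNormMap σ 3), ∀ j, D' j = D₁ j * ((r j : Kˣ) : K) * ((n j : Kˣ) : K)} from rfl,
    classLabelSign_cl_eq_of_classSign hσc hc hdich hD₁ hNS Λ i hlamN hΛ (hRS r hr), two_mul_ite_eq_mul_one_add (hlam r (hRS r hr)), mul_assoc]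

end Summit.HodgeConjecture.HodgeConjecture.Cruxes.H413.F0P3cDyRamLabelledOddClassSignRead

end
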